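import Summits.HodgeConjecture.CorCM.HypDel.ExtAmbientReceptacleQArchA
import HarnessLib

/-!
# τ0-T3 v4 (B/2) — the stub statements `SQuot`, `S4Push`, and the HEAD `ambientReceptacle_of : SiegelS1 → FrameExists → S2Inj → S2Pair → S2Imm → SQuot → S4Push → AmbientReceptacleExists`

Cell `hodgecm-mathlib`, crux `HDel` (stmt-HodgeConjecture-24835), fan B / B-plan2 (T3 pen), KEY `t3-tau0-v4-qarch-port` (B-p19 g5).
τ0 PORT of the v4 «Q-ARCHITECTURE» of the HDel crux workfile (draft `B-plan/specs/F1ExtHodgeType.v4-draft.B-plan2g4.lean` sha16 0f5fc804bbb4dcb3,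
§8, re-cut 14:57Z with `S2Inj` in TOWER form; probe-e 472e67d5 kernel-green against the real (σ4)-D, sorries = the 7 stubs only): the receptacle
`AmbientReceptacleExists` (★ τ0-T3 F1 `CorCM/HypDel/ExtAmbientReceptacle.lean`) ⟸ seven registered stubs (S1 · frame · S2inj · S2pair · S2imm ·
Squot · S4) along Deligne's construction [Del71, §5; Del79, 2.3.10]: the receptacle is a FINITE QUOTIENT of a principal-level SIEGEL modular
variety reached through the symplectic embedding of the auxiliary datum (★ (g-b) `auxComplexStructure`) at a PRODUCT level, followed by the
quotient by a finite group acting through integral Hecke operators of the Siegel ℚ-model (★ (σ4)-D `SiegelCanonicalModel`).  The vocabulary,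
the stub statements and the head are relocated VERBATIM (token-identical; only namespace / opens / imports change) into importable modules in
TWO parts, so that the stub owners (B-p03 frame, A-p05 S2inj/S4, B-p05 S2imm, B-p02+B-p06 Squot, the (σ5) consumer for S2pair) conclude them
BY NAME and the workfile shrinks to «imports + 7 `stub_*` + `HDel_proof`»: PART A (`…QArchA.lean`: vocabulary incl. `GaloisIntertwines`,
`FrameExists`, `three_le_mul_succ`, `S2Inj`, `S2Pair`, `S2Imm`) and PART B (`…QArchB.lean`: `SQuot`, `S4Push` and the HEAD `ambientReceptacle_of`).
Statements characterise construction data ONLY through POINT FORMULAS and `GaloisIntertwines`, never through chosen isomorphisms.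
CIRCULARITY RULE (REF1): nothing here consumes `exists_recordSystem` / `canonicalModel_exists_printed` / any `(S : RecordSystem …)`.
NOTHING IS ASSERTED (defs of `Prop`s, one arithmetic lemma, one kernel-checked head; 0 `sorry`; no instance, no notation).

THIS FILE (B/2): draft :215–:261 (`SQuot` :216, `S4Push` :243) and the head :313–:356 VERBATIM (its conclusion is ★ F1 `ExtReceptacle.AmbientReceptacleExists`
BY NAME).  Imports: part A (which carries (σ4)-D).
HC_CM is proved only modulo the 7 printed citations until rung 0 closes; nothing in this file is a proof of I-1′ or of `HDel`.
[cite: Deligne1971TravauxShimura, §5, Thm 4.21, 1.15, 5.4] [cite: Deligne1979ShimuraVarieties, Prop. 2.3.10] [cite: Milne2005ShimuraVarieties, §14 Prop 14.12, §12 (62)]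
-/

noncomputable section

open Function MulAction Topology NumberField IsDedekindDomain CategoryTheory CategoryTheory.Limits Matrix
  AlgebraicGeometry
open scoped Matrix ComplexOrder
open Literature.AlgebraicGeometry Literature.AlgebraicGeometry.Motives
open Literature.NumberTheory.Automorphic Literature.NumberTheory.Automorphic.UnitaryGroup
open Literature.NumberTheory.Automorphic.Liu2021.AppendixC (C5.OpenCompactSubgroup C5.SmallLevel)
open Literature.Geometry.ComplexHyperbolic Literature.Geometry.ComplexHyperbolic.BallModel
open Literature.AlgebraicGeometry.ShimuraVarieties Literature.AlgebraicGeometry.ShimuraVarieties.UnitaryCanonicalModel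
open Literature.AlgebraicGeometry.ShimuraVarieties.UnitaryCanonicalModel.Aux
open Literature.AlgebraicGeometry.ModuliOfAbelianVarieties
open Literature.NumberTheory.ComplexMultiplication (traceField reflexNormFiniteIdele)
open Literature.NumberTheory.AdelicBaseChange (finiteIdeleRelNorm)
open Summit.HodgeConjecture.CorCM.HypDel.ExtReceptacle (ReciprocityThrough AmbientReceptacle AmbientReceptacleExists)

namespace Summit.HodgeConjecture.CorCM.HypDel.ExtReceptacle.QArch

/-! ### The stub statements as CLOSED Props, continued: Squot · S4 -/

/-- **Squot (owners B-p02 + B-p06).** -/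
def SQuot : Prop :=
  ∀ (L : Type) [Field L] [NumberField L] [IsCMField L] (H : Matrix (Fin 3) (Fin 3) L) (τ : L →+* ℂ)
    (T : GL (Fin 3) ℂ) (hT : formCongr (starRingEnd ℂ) T (H.map τ) = BallModel.J),
    (∀ τ' : L →+* ℂ, InfinitePlace.mk τ' ≠ InfinitePlace.mk τ → (H.map τ').PosDef) →
    (∀ v : Fin 3 → L, ShimuraVarieties.hermForm (cmConjRingHom L) H v v = 0 → v = 0) →
    ∀ K₀ : C5.OpenCompactSubgroup ↥(finAdelic (↥(maximalRealSubfield L)) L (IsCMField.complexConj L) 3 H),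
      (∀ g : finAdelic (↥(maximalRealSubfield L)) L (IsCMField.complexConj L) 3 H,
        ∀ γ ∈ arithmeticLevel (↥(maximalRealSubfield L)) L (IsCMField.complexConj L) 3 H
          (K₀.1.map (MulAut.conj g).toMonoidHom), IsOfFinOrder γ → γ = 1) →
        ∀ (Sc : ComplexRecordSystem L H τ T hT K₀) (M : Type) [Field M] [NumberField M] [IsCMField M] (j : L →+* M)
          (Φ : CMType M), IsExtAdapted τ j Φ →
          ∀ (E : IntermediateField ℚ ℂ) [FiniteDimensional ℚ ↥E] (hE : ∀ x : L, τ x ∈ E), traceField Φ ≤ E →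
            ∀ (L₀ : C5.OpenCompactSubgroup ↥(torusFinAdelic M)) (K : C5.SmallLevel K₀),
            ∀ (ξ₀ ξ : M) (g : ℕ) (δ : Fin g → ℕ) (F : SymplecticFrame M j H ξ₀ ξ g δ),
              IsAuxScalars M Φ ξ₀ ξ → 0 < g → IsPolarizationType δ → ∀ (hJ : ∀ x : Ball, auxComplexStructure F τ Φ T x ∈ C0pm δ), K.1.1.prod L₀.1 ≤ auxLevel F 1 →
              ∀ (Sg : SiegelComplexRecordSystem g δ) (R : SiegelRationalModel g δ Sg), R.HasIntegralHecke →
              ∀ (N : ℕ) (hN : 3 ≤ N) (KV : C5.SmallLevel K₀) (LV : C5.OpenCompactSubgroup ↥(torusFinAdelic M)),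
                KV ≤ K → LV ≤ L₀ → IsProductLevel M F N KV.1.1 LV.1 → auxLevel F N ≤ K.1.1.prod L₀.1 →
                (∀ x ∈ K.1.1.prod L₀.1, ∀ y ∈ auxLevel F N, x⁻¹ * y * x ∈ auxLevel F N) →
                ∀ ι' : (complexSystemExt M Sc LV).obj KV ⟶ Sg.Mc.obj (SiegelLevel.ofNat δ N hN),
                  IsClosedImmersion ι'.left → PointFormulaN M Sc Φ F hJ LV KV Sg (SiegelLevel.ofNat δ N hN) ι' →
                  ∃ (A : SchemeOver ↥E) (ι : (complexSystemExt M Sc L₀).obj K ⟶ (Motives.baseChange ↥E ℂ).obj A)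
                    (Ψ : ComplexPoints (Sg.Mc.obj (SiegelLevel.ofNat δ N hN)) → ComplexPoints ((Motives.baseChange ↥E ℂ).obj A)),
                    IsClosedImmersion ι.left ∧ PointFormulaK M Sc Φ F hJ L₀ K Sg (SiegelLevel.ofNat δ N hN) A ι Ψ ∧
                      GaloisIntertwines R (SiegelLevel.ofNat δ N hN) A Ψ

/-- **S4 (owner A-p05): Siegel reciprocity pushed down along `Ψ`.** -/
def S4Push : Prop :=
  ∀ (L : Type) [Field L] [NumberField L] [IsCMField L] (H : Matrix (Fin 3) (Fin 3) L) (τ : L →+* ℂ)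
    (T : GL (Fin 3) ℂ) (hT : formCongr (starRingEnd ℂ) T (H.map τ) = BallModel.J),
    (∀ τ' : L →+* ℂ, InfinitePlace.mk τ' ≠ InfinitePlace.mk τ → (H.map τ').PosDef) →
    (∀ v : Fin 3 → L, ShimuraVarieties.hermForm (cmConjRingHom L) H v v = 0 → v = 0) →
    ∀ K₀ : C5.OpenCompactSubgroup ↥(finAdelic (↥(maximalRealSubfield L)) L (IsCMField.complexConj L) 3 H),
      (∀ g : finAdelic (↥(maximalRealSubfield L)) L (IsCMField.complexConj L) 3 H,
        ∀ γ ∈ arithmeticLevel (↥(maximalRealSubfield L)) L (IsCMField.complexConj L) 3 H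
          (K₀.1.map (MulAut.conj g).toMonoidHom), IsOfFinOrder γ → γ = 1) →
        ∀ (Sc : ComplexRecordSystem L H τ T hT K₀) (M : Type) [Field M] [NumberField M] [IsCMField M] (j : L →+* M)
          (Φ : CMType M), IsExtAdapted τ j Φ →
          ∀ (E : IntermediateField ℚ ℂ) [FiniteDimensional ℚ ↥E] (hE : ∀ x : L, τ x ∈ E), traceField Φ ≤ E →
            ∀ (L₀ : C5.OpenCompactSubgroup ↥(torusFinAdelic M)) (K : C5.SmallLevel K₀),
            ∀ (ξ₀ ξ : M) (g : ℕ) (δ : Fin g → ℕ) (F : SymplecticFrame M j H ξ₀ ξ g δ),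
              IsAuxScalars M Φ ξ₀ ξ → 0 < g → IsPolarizationType δ → ∀ (hJ : ∀ x : Ball, auxComplexStructure F τ Φ T x ∈ C0pm δ), K.1.1.prod L₀.1 ≤ auxLevel F 1 →
              ∀ (Sg : SiegelComplexRecordSystem g δ) (R : SiegelRationalModel g δ Sg), R.IsCanonical →
              ∀ (KN : SiegelLevel δ) (A : SchemeOver ↥E) (ι : (complexSystemExt M Sc L₀).obj K ⟶ (Motives.baseChange ↥E ℂ).obj A)
                (Ψ : ComplexPoints (Sg.Mc.obj KN) → ComplexPoints ((Motives.baseChange ↥E ℂ).obj A)),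
                PointFormulaK M Sc Φ F hJ L₀ K Sg KN A ι Ψ → GaloisIntertwines R KN A Ψ → ReciprocityThrough M Φ E hE L₀ Sc K A ι

/-! ### The HEAD: `AmbientReceptacleExists` ⟸ the seven statements (kernel-checked; the seven are the registered stubs of the workfile v4) -/

/-- **HEAD of §8 (kernel-checked, no `sorry` of its own).** -/
theorem ambientReceptacle_of (h1 : SiegelS1) (hF : FrameExists) (h2i : S2Inj) (h2p : S2Pair) (h2c : S2Imm) (hQ : SQuot)
    (h4 : S4Push) : AmbientReceptacleExists := by
  intro L _ _ _ H τ T hT hpos hanis K₀ htf Sc M _ _ _ j Φ hΦ E _ hE hΦE L₀ K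
  -- frame + scalars
  obtain ⟨ξ₀, ξ, g, δ, F, N₁, hsc, hg, hδ, hJall, hN₁, hle1, hlev⟩ := hF L H τ hpos hanis K₀ M j Φ hΦ L₀ K
  have hJ : ∀ x : Ball, auxComplexStructure F τ Φ T x ∈ C0pm δ := hJall T hT
  -- Siegel canonical model
  obtain ⟨Sg, R, hcan, hhecke⟩ := h1 g δ hg hδ
  -- the injectivity tower over N' = 3 · N₁ : product levels from the frame, morphisms from S2pair at every level
  set N' : ℕ := 3 * N₁ with hN'def
  have hN' : 3 ≤ N' := by
    calc 3 = 3 * 1 := by norm_num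
      _ ≤ 3 * N₁ := Nat.mul_le_mul_left 3 hN₁
      _ = N' := by rw [hN'def]
  have htower : ∀ m : ℕ, ∃ (KV : C5.SmallLevel K₀) (LV : C5.OpenCompactSubgroup ↥(torusFinAdelic M)),
      KV ≤ K ∧ LV ≤ L₀ ∧ IsProductLevel M F (N' * (m + 1)) KV.1.1 LV.1 :=
    fun m => (hlev (N' * (m + 1)) ⟨3 * (m + 1), by rw [hN'def]; ring⟩).2.2
  choose KV LV hKV hLV hprod using htower
  have hιex : ∀ m : ℕ, ∃ ι' : (complexSystemExt M Sc (LV m)).obj (KV m) ⟶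
      Sg.Mc.obj (SiegelLevel.ofNat δ (N' * (m + 1)) (three_le_mul_succ hN' m)),
      PointFormulaN M Sc Φ F hJ (LV m) (KV m) Sg (SiegelLevel.ofNat δ (N' * (m + 1)) (three_le_mul_succ hN' m)) ι' :=
    fun m => h2p L H τ T hT hpos hanis K₀ htf Sc M j Φ hΦ ξ₀ ξ g δ F hsc hg hδ hJ Sg (N' * (m + 1)) (three_le_mul_succ hN' m)
      (KV m) (LV m) (hprod m)
  choose ι hpfι using hιex
  -- injectivity at some tower level m₀; the working level N = N' · (m₀ + 1)
  obtain ⟨m₀, hpi⟩ := h2i L H τ T hT hpos hanis K₀ htf Sc M j Φ hΦ ξ₀ ξ g δ F hsc hg hδ hJ Sg N' hN' KV LV hprod ι hpfι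
  set N : ℕ := N' * (m₀ + 1) with hNdef
  have hN3 : 3 ≤ N := three_le_mul_succ hN' m₀
  have hN₁N : N₁ ∣ N := ⟨3 * (m₀ + 1), by rw [hNdef, hN'def]; ring⟩
  obtain ⟨hle, hnorm, -⟩ := hlev N hN₁N
  -- S2 at the working level
  have hpf : PointFormulaN M Sc Φ F hJ (LV m₀) (KV m₀) Sg (SiegelLevel.ofNat δ N hN3) (ι m₀) := hpfι m₀
  have himm' : IsClosedImmersion (ι m₀).left :=
    h2c L H τ T hT hpos hanis K₀ htf Sc M j Φ hΦ ξ₀ ξ g δ F hsc hg hδ hJ Sg N hN3 (KV m₀) (LV m₀) (hprod m₀) (ι m₀) hpf hpi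
  -- quotient receptacle over E
  obtain ⟨A, ι, Ψ, himm, hpfK, hgal⟩ :=
    hQ L H τ T hT hpos hanis K₀ htf Sc M j Φ hΦ E hE hΦE L₀ K ξ₀ ξ g δ F hsc hg hδ hJ hle1 Sg R hhecke N hN3 (KV m₀) (LV m₀)
      (hKV m₀) (hLV m₀) (hprod m₀) hle hnorm (ι m₀) himm' hpf
  -- reciprocity pushed down
  have hrec : ReciprocityThrough M Φ E hE L₀ Sc K A ι :=
    h4 L H τ T hT hpos hanis K₀ htf Sc M j Φ hΦ E hE hΦE L₀ K ξ₀ ξ g δ F hsc hg hδ hJ hle1 Sg R hcan (SiegelLevel.ofNat δ N hN3) A ι Ψ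
      hpfK hgal
  exact ⟨⟨A, ι, himm, hrec⟩⟩

end Summit.HodgeConjecture.CorCM.HypDel.ExtReceptacle.QArch

end
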